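import Summits.BirchSwinnertonDyer.BirchSwinnertonDyer.Theorems.ManinLocalTwoThreeTameThreeNeronScalarIII
import Summits.BirchSwinnertonDyer.BirchSwinnertonDyer.Theorems.ManinLocalTwoThreeThirdLatticeVelu
import Literature.NumberTheory.EllipticCurves.LatticeIndexThreeVeluProofs
import Literature.NumberTheory.EllipticCurves.NeronIsogenyScalingHoldsProofs
import Literature.NumberTheory.EllipticCurves.EichlerShimuraConstructionProofs
import Literature.NumberTheory.EllipticCurves.ModularCurveNeronLatticeProofs
import Literature.NumberTheory.EllipticCurves.ComplexTorus
import HarnessLib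

/-!
# The Néron-scaling dichotomy of the Vélu `3`-quotient by a rational `3`-line, and the EXISTENCE conjuncts of the tame
# Néron-scalar law at `3` (E-an-107 conjunct 1 on `III`, E-an-108 conjunct 2 on `III*`, PROVED)

Summit `BirchSwinnertonDyer`, route `ManinLocalTwoThree` (cell bsd-f2-manin), crux C3 `ManinPrimeToThreeAtNine`
(stmt-BirchSwinnertonDyer-22968); sequel of `…TameThreeNeronScalarIIIstar` (p642603) and `…TameThreeNeronScalarIII` (p643391).

* `exists_isGloballyMinimal_dvd_three_velu_three` — **the dichotomy** (ANY globally minimal `W/ℚ`, any reduction): for a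
  rational `3`-line (short-model abscissa `q`, `Ψ₃(q − b₂/12) = 0`) whose `u = 1` Vélu pair
  `(A, B) = (1440q² − 9c₄, 60480q³ − 756c₄q − 27c₆)` is nonsingular (`A³ ≠ B²`), there are a globally minimal `W'/ℚ` and an
  integer `k ∣ 3` with `k⁴c₄(W') = A`, `k⁶c₆(W') = B` — the global minimal model `W'` of Vélu's curve has Néron lattice
  `u·(Λ_W + ℤz₀)` and `u ∈ ℤ`, `u ∣ 3` by the tree's Néron-mapping-property substitute
  (`exists_int_eq_and_dvd_of_neronScaling`: a rational Néron scaling of a lattice `3`-isogeny between globally minimal models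
  divides `3`; Dokchitser–Dokchitser 2015 Lemma 10/11).  Ingredients: `℘_Λ` attains `q` (`PeriodPair.exists_weierstrassP_eq`),
  `Ψ₃(℘(z₀)) = 0 ⟹ 3z₀ ∈ Λ` (`eval_ΨSq_weierstrassP_eq_zero_iff`), Vélu's lattice `Λ_V = Λ + ℤz₀`
  (`lattice_eq_of_velu_three_invariants`), `Λ_{C • V} = uΛ_V` (`IsNeronLatticeOf.lattice_eq_mulLeft_of_smul`), global minimal
  models exist (`hasGlobalMinimalModel_rat_holds`).
* `exists_isGloballyMinimal_velu_three_of_III` — **E-an-107 conjunct 1** (`VeluPairMinimal`): on a tame `III` curve every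
  rational `3`-line has `u = 1`: a globally minimal curve CARRIES the Vélu pair (the `k = ±3` branch is excluded by
  `not_exists_isGloballyMinimal_three_velu_three_of_III`, p643391).
* `exists_isGloballyMinimal_three_velu_three_of_IIIstar` — **E-an-108 conjunct 2** (`VeluPairThriceMinimal`): on a tame
  pot.-good `III*` curve every rational `3`-line has `u = 3`: a globally minimal curve carries `(3⁻⁴A, 3⁻⁶B)` (the `k = ±1`
  branch is excluded by `not_exists_isGloballyMinimal_velu_three_of_IIIstar`, p642603).

With p642603/p643391/p643687 this makes MEMO-an §66's E-an-107 and E-an-108 THEOREMS in all conjuncts (after unfolding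
an's `VeluPairMinimal`/`VeluPairThriceMinimal`/`veluC4`/`veluC6`).  HONEST FRAMING: local/lattice theorems; C3, Manin's
conjecture and BSD are not proved.  No definitions, no named facts, no sorry.

References: [DokchitserDokchitser2015LocalInvariants] §4 Lemma 10–11, Table 1; [SilvermanAEC2009] III.4.12 (Vélu), VI.3.6,
VII.1, VIII.8; [SilvermanATAEC1994] IV.9.4 Table 4.1; J. Vélu, C. R. Acad. Sci. Paris 273 (1971); HOME/MEMO-an.md §66.
-/

set_option linter.dupNamespace false
set_option autoImplicit false

noncomputable section

open scoped Classical

open WeierstrassCurve IsDedekindDomain NumberField Rat.HeightOneSpectrum Polynomial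
  Literature.NumberTheory.DiophantineGeometry Literature.NumberTheory.EllipticCurves
  Literature.NumberTheory.EllipticCurves.ModularForms
  Summit.BirchSwinnertonDyer.Rank1Residual.Additive

namespace Summit.BirchSwinnertonDyer.BirchSwinnertonDyer.Theorems.ManinLocalTwoThree

/-! ### §1. From a rational root of `Ψ₃` to a third-period -/

/-- **A rational root of `Ψ₃` is the abscissa of a third-period**: if `W.Ψ₃(q − b₂/12) = 0` and `L` is a Néron-type period
pair of `W/ℂ` (`g₂ = c₄/12`, `g₃ = c₆/216`), there is `z₀ ∉ Λ` with `℘_Λ(z₀) = q` and `3z₀ ∈ Λ`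
(`℘` attains every value; `Ψ₃(℘(z₀)) = 0 ⟺ 3z₀ ∈ Λ`). [cite: SilvermanAEC2009, Prop. VI.3.6(b) and Exercise 3.7(f)] -/
theorem exists_third_period_of_Ψ₃_root (W : WeierstrassCurve ℚ) [W.IsElliptic] {L : PeriodPair}
    (hL : IsNeronLatticeOf (W.baseChange ℂ) L) (q : ℚ) (hq : W.Ψ₃.eval (q - W.b₂ / 12) = 0) :
    ∃ z₀ : ℂ, z₀ ∉ L.lattice ∧ L.weierstrassP z₀ = (q : ℂ) ∧ 3 * z₀ ∈ L.lattice := by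
  obtain ⟨z₀, hz₀, hx₀⟩ := L.exists_weierstrassP_eq (q : ℂ)
  refine ⟨z₀, hz₀, hx₀, ?_⟩
  have hc₄ : (W.baseChange ℂ).c₄ = (W.c₄ : ℂ) := by simp [WeierstrassCurve.baseChange, WeierstrassCurve.map_c₄]
  have hc₆ : (W.baseChange ℂ).c₆ = (W.c₆ : ℂ) := by simp [WeierstrassCurve.baseChange, WeierstrassCurve.map_c₆]
  have hg₂ : L.g₂ = (W.c₄ : ℂ) / 12 := by rw [hL.1, hc₄]
  have hg₃ : L.g₃ = (W.c₆ : ℂ) / 216 := by rw [hL.2, hc₆]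
  -- the root relation over `ℚ`, on the short model
  rw [Ψ₃_eval_sub_b₂_div_twelve] at hq
  simp only [WeierstrassCurve.Ψ₃, WeierstrassCurve.b₂, WeierstrassCurve.b₄, WeierstrassCurve.b₆, WeierstrassCurve.b₈,
    eval_add, eval_mul, eval_pow, eval_C, eval_X, eval_ofNat] at hq
  have hqC : ((3 * q ^ 4 - W.c₄ / 8 * q ^ 2 - W.c₆ / 72 * q - W.c₄ ^ 2 / 2304 : ℚ) : ℂ) = 0 := by
    have h : (3 * q ^ 4 - W.c₄ / 8 * q ^ 2 - W.c₆ / 72 * q - W.c₄ ^ 2 / 2304 : ℚ) = 0 := by linear_combination hq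
    rw [h]; simp
  push_cast at hqC
  -- `Ψ₃` of `E_Λ` vanishes at `℘(z₀)`
  have hΨ₃ : L.curve.Ψ₃.eval (L.weierstrassP z₀) = 0 := by
    simp only [WeierstrassCurve.Ψ₃, WeierstrassCurve.b₂, WeierstrassCurve.b₄, WeierstrassCurve.b₆, WeierstrassCurve.b₈,
      PeriodPair.curve_a₁, PeriodPair.curve_a₂, PeriodPair.curve_a₃, PeriodPair.curve_a₄, PeriodPair.curve_a₆, eval_add,
      eval_mul, eval_pow, eval_C, eval_X, eval_ofNat, hx₀, hg₂, hg₃]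
    linear_combination hqC
  have hΨ : (L.curve.ΨSq 3).eval (L.weierstrassP z₀) = 0 := by
    rw [WeierstrassCurve.ΨSq_three, eval_pow, hΨ₃]; ring
  exact_mod_cast (L.eval_ΨSq_weierstrassP_eq_zero_iff hz₀ 3).mp hΨ

/-! ### §2. The Néron-scaling dichotomy of the Vélu `3`-quotient -/

/-- **The global minimal model of the Vélu `3`-quotient carries the Vélu pair up to `k ∈ {±1, ±3}`.**  `W/ℚ` globally minimal
(any reduction), `q` the short-model abscissa of a rational `3`-line (`Ψ₃(q − b₂/12) = 0`) with nonsingular `u = 1` Vélu pair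
`(A, B)` (`A³ ≠ B²`): there are a globally minimal elliptic `W'/ℚ` and `k ∈ ℤ`, `k ∣ 3`, with `k⁴c₄(W') = A`, `k⁶c₆(W') = B`.
[cite: DokchitserDokchitser2015LocalInvariants, §4 Lemma 10 (1) and proof of Lemma 11] [cite: SilvermanAEC2009, III.4.12 and VIII.8.3] -/
theorem exists_isGloballyMinimal_dvd_three_velu_three (W : WeierstrassCurve ℚ) [W.IsElliptic] [W.IsGloballyMinimal]
    (q : ℚ) (hq : W.Ψ₃.eval (q - W.b₂ / 12) = 0)
    (hΔ : (1440 * q ^ 2 - 9 * W.c₄) ^ 3 ≠ (60480 * q ^ 3 - 756 * W.c₄ * q - 27 * W.c₆) ^ 2) :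
    ∃ (W' : WeierstrassCurve ℚ) (k : ℤ), W'.IsElliptic ∧ W'.IsGloballyMinimal ∧ k ∣ 3 ∧
      (k : ℚ) ^ 4 * W'.c₄ = 1440 * q ^ 2 - 9 * W.c₄ ∧
      (k : ℚ) ^ 6 * W'.c₆ = 60480 * q ^ 3 - 756 * W.c₄ * q - 27 * W.c₆ := by
  -- Vélu's curve (short model with the pair) and its global minimal model
  set A : ℚ := 1440 * q ^ 2 - 9 * W.c₄ with hA
  set B : ℚ := 60480 * q ^ 3 - 756 * W.c₄ * q - 27 * W.c₆ with hB
  set V : WeierstrassCurve ℚ := ⟨0, 0, 0, -A / 48, -B / 864⟩ with hV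
  have hV4 : V.c₄ = A := by
    simp only [hV, WeierstrassCurve.c₄, WeierstrassCurve.b₂, WeierstrassCurve.b₄]; ring
  have hV6 : V.c₆ = B := by
    simp only [hV, WeierstrassCurve.c₆, WeierstrassCurve.b₂, WeierstrassCurve.b₄, WeierstrassCurve.b₆]; ring
  have hVΔ : V.Δ = (A ^ 3 - B ^ 2) / 1728 := by
    have h := V.c_relation; rw [hV4, hV6] at h; linear_combination h / 1728
  haveI hVell : V.IsElliptic := ⟨isUnit_iff_ne_zero.mpr (by rw [hVΔ]; exact div_ne_zero (sub_ne_zero.mpr hΔ) (by norm_num))⟩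
  obtain ⟨C, hC⟩ := WeierstrassCurve.hasGlobalMinimalModel_rat_holds V
  haveI := hC
  set u : ℚ := (C.u : ℚ) with hu
  have hu0 : u ≠ 0 := C.u.ne_zero
  have hW'4 : (C • V).c₄ = (u ^ 4)⁻¹ * A := by rw [variableChange_c₄, hV4, Units.val_inv_eq_inv_val, inv_pow]
  have hW'6 : (C • V).c₆ = (u ^ 6)⁻¹ * B := by rw [variableChange_c₆, hV6, Units.val_inv_eq_inv_val, inv_pow]
  -- lattices
  haveI : (V.baseChange ℂ).IsElliptic := by rw [WeierstrassCurve.baseChange]; infer_instance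
  haveI : (W.baseChange ℂ).IsElliptic := by rw [WeierstrassCurve.baseChange]; infer_instance
  haveI : ((C • V).baseChange ℂ).IsElliptic := by rw [WeierstrassCurve.baseChange]; infer_instance
  obtain ⟨L₀, hL₀⟩ := exists_isNeronLatticeOf_holds (W.baseChange ℂ)
  obtain ⟨LV, hLV⟩ := exists_isNeronLatticeOf_holds (V.baseChange ℂ)
  obtain ⟨L', hL'⟩ := exists_isNeronLatticeOf_holds ((C • V).baseChange ℂ)
  have hΛ' : L'.lattice = (LV.mulLeft ((C.u : ℚ) : ℂ) (by exact_mod_cast C.u.ne_zero)).lattice :=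
    IsNeronLatticeOf.lattice_eq_mulLeft_of_smul C hLV hL'
  -- the third-period and Vélu's lattice `Λ_V = Λ₀ + ℤz₀`
  obtain ⟨z₀, hz₀, hx₀, h3⟩ := exists_third_period_of_Ψ₃_root W hL₀ q hq
  have hc₄W : (W.baseChange ℂ).c₄ = (W.c₄ : ℂ) := by simp [WeierstrassCurve.baseChange, WeierstrassCurve.map_c₄]
  have hc₆W : (W.baseChange ℂ).c₆ = (W.c₆ : ℂ) := by simp [WeierstrassCurve.baseChange, WeierstrassCurve.map_c₆]
  have hc₄V : (V.baseChange ℂ).c₄ = (V.c₄ : ℂ) := by simp [WeierstrassCurve.baseChange, WeierstrassCurve.map_c₄]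
  have hc₆V : (V.baseChange ℂ).c₆ = (V.c₆ : ℂ) := by simp [WeierstrassCurve.baseChange, WeierstrassCurve.map_c₆]
  have h₂ : LV.g₂ = 120 * L₀.weierstrassP z₀ ^ 2 - 9 * L₀.g₂ := by
    rw [hLV.1, hc₄V, hV4, hx₀, hL₀.1, hc₄W, hA]; push_cast; ring
  have h₃ : LV.g₃ = 280 * L₀.weierstrassP z₀ ^ 3 - 42 * L₀.g₂ * L₀.weierstrassP z₀ - 27 * L₀.g₃ := by
    rw [hLV.2, hc₆V, hV6, hx₀, hL₀.1, hL₀.2, hc₄W, hc₆W, hB]; push_cast; ring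
  obtain ⟨hle, -, hidx⟩ := L₀.lattice_eq_of_velu_three_invariants hz₀ h3 LV h₂ h₃
  -- the Néron scaling `u` of `z ↦ u z : ℂ/Λ₀ → ℂ/Λ' = ℂ/(uΛ_V)` divides `3`
  have hu0' : (u : ℂ) ≠ 0 := by exact_mod_cast hu0
  have h3mul : ∀ w : ℂ, w ∈ L₀.lattice → 3 * w ∈ L₀.lattice := fun w hw ↦ by
    have e : (3 : ℂ) * w = w + w + w := by ring
    rw [e]; exact add_mem (add_mem hw hw) hw
  have h3v : ∀ v : ℂ, v ∈ LV.lattice → 3 * v ∈ L₀.lattice := fun v hv ↦ by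
    rcases hidx v hv with h | h | h
    · exact h3mul v h
    · have e : (3 : ℂ) * v = 3 * (v - z₀) + 3 * z₀ := by ring
      rw [e]; exact add_mem (h3mul _ h) h3
    · have e : (3 : ℂ) * v = 3 * (v + z₀) - 3 * z₀ := by ring
      rw [e]; exact sub_mem (h3mul _ h) h3
  have hμ : ∀ y ∈ L₀.lattice, ((u : ℚ) : ℂ) * y ∈ L'.lattice := fun y hy ↦ by
    rw [hΛ']
    exact PeriodPair.mul_mem_mulLeft_lattice.mpr (hle hy)
  have hnμ : ∀ z ∈ L'.lattice, ∃ y ∈ L₀.lattice, ((3 : ℤ) : ℂ) * z = ((u : ℚ) : ℂ) * y := fun z hz ↦ by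
    rw [hΛ', PeriodPair.mem_mulLeft_lattice] at hz
    refine ⟨3 * (((u : ℚ) : ℂ)⁻¹ * z), h3v _ hz, ?_⟩
    field_simp
    push_cast; ring
  obtain ⟨k, hk, hk3⟩ :=
    exists_int_eq_and_dvd_of_neronScaling W (C • V) L₀ L' hL₀ hL' u (n := 3) three_ne_zero hμ hnμ
  refine ⟨C • V, k, inferInstance, hC, hk3, ?_, ?_⟩
  · rw [hW'4, hk]; field_simp
  · rw [hW'6, hk]; field_simp

/-! ### §3. The existence conjuncts of the tame law -/

/-- The divisors of `3` in `ℤ`. -/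
private theorem int_dvd_three {k : ℤ} (hk : k ∣ 3) : k = 1 ∨ k = -1 ∨ k = 3 ∨ k = -3 := by
  have h1 : k.natAbs ∣ 3 := by exact_mod_cast Int.natAbs_dvd_natAbs.mpr hk
  have h2 : k.natAbs = 1 ∨ k.natAbs = 3 := by
    have := (Nat.dvd_prime Nat.prime_three).mp h1; exact this
  omega

/-- **E-an-107 `TameThreeNeronScalarLawIII`, conjunct 1 (`VeluPairMinimal`; cell bsd-f2-manin, MEMO-an §66; census 8 650 /
8 650 `III → III*` rational `3`-isogenies at `v₃N = 2`, all `u = 1`): on a globally minimal `W/ℚ`, TAME at `3` (`9 ∥ N`) with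
`ord₃ Δ_min = 3` (type `III`), for every rational `3`-line (`Ψ₃(q − b₂/12) = 0`) some globally minimal curve `W'/ℚ` carries
the `u = 1` Vélu pair: `c₄(W') = 1440q² − 9c₄(W)`, `c₆(W') = 60480q³ − 756c₄(W)q − 27c₆(W)`** — i.e. `u(W → W/C) = 1`.
[cite: DokchitserDokchitser2015LocalInvariants, Table 1 (l = p, pot.-good)] [cite: SilvermanATAEC1994, IV.9.4 Table 4.1] -/
theorem exists_isGloballyMinimal_velu_three_of_III (W : WeierstrassCurve ℚ) [W.IsElliptic] [W.IsGloballyMinimal]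
    (h9 : 3 ^ 2 ∣ W.conductorNorm ℤ) (h27 : ¬ 3 ^ 3 ∣ W.conductorNorm ℤ)
    (hΔ : padicValInt 3 W.minimalDiscriminantInt = 3) (q : ℚ) (hq : W.Ψ₃.eval (q - W.b₂ / 12) = 0) :
    ∃ W' : WeierstrassCurve ℚ, W'.IsElliptic ∧ W'.IsGloballyMinimal ∧
      W'.c₄ = 1440 * q ^ 2 - 9 * W.c₄ ∧ W'.c₆ = 60480 * q ^ 3 - 756 * W.c₄ * q - 27 * W.c₆ := by
  -- the pair is nonsingular: `64Δ = 3⁹U ≠ 0` for its short carrier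
  obtain ⟨U, hU3, hT⟩ := exists_unit_velu_three_Δ_of_III W h9 h27 hΔ q hq
  set V : WeierstrassCurve ℚ := ⟨0, 0, 0, -(1440 * q ^ 2 - 9 * W.c₄) / 48,
    -(60480 * q ^ 3 - 756 * W.c₄ * q - 27 * W.c₆) / 864⟩ with hV
  have hV4 : V.c₄ = 1440 * q ^ 2 - 9 * W.c₄ := by
    simp only [hV, WeierstrassCurve.c₄, WeierstrassCurve.b₂, WeierstrassCurve.b₄]; ring
  have hV6 : V.c₆ = 60480 * q ^ 3 - 756 * W.c₄ * q - 27 * W.c₆ := by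
    simp only [hV, WeierstrassCurve.c₆, WeierstrassCurve.b₂, WeierstrassCurve.b₄, WeierstrassCurve.b₆]; ring
  have hne : (1440 * q ^ 2 - 9 * W.c₄) ^ 3 ≠ (60480 * q ^ 3 - 756 * W.c₄ * q - 27 * W.c₆) ^ 2 := by
    intro h
    have hU0 : (U : ℚ) ≠ 0 := by
      have : U ≠ 0 := fun h0 ↦ hU3 (h0 ▸ dvd_zero 3)
      exact_mod_cast this
    have h64 := hT V hV4 hV6
    have hrel := V.c_relation
    rw [hV4, hV6, h, sub_self] at hrel
    have hV0 : V.Δ = 0 := by linear_combination hrel / 1728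
    rw [hV0, mul_zero] at h64
    exact (mul_ne_zero (pow_ne_zero 9 three_ne_zero) hU0) h64.symm
  obtain ⟨W', k, hW'e, hW'm, hk3, h4, h6⟩ := exists_isGloballyMinimal_dvd_three_velu_three W q hq hne
  rcases int_dvd_three hk3 with rfl | rfl | rfl | rfl
  · exact ⟨W', hW'e, hW'm, by linear_combination h4, by linear_combination h6⟩
  · exact ⟨W', hW'e, hW'm, by linear_combination h4, by linear_combination h6⟩
  · exfalso
    exact not_exists_isGloballyMinimal_three_velu_three_of_III W h9 h27 hΔ q hq
      ⟨W', hW'e, hW'm, by exact_mod_cast h4, by exact_mod_cast h6⟩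
  · exfalso
    refine not_exists_isGloballyMinimal_three_velu_three_of_III W h9 h27 hΔ q hq ⟨W', hW'e, hW'm, ?_, ?_⟩
    · rw [← h4]; push_cast; ring
    · rw [← h6]; push_cast; ring

/-- **E-an-108 `TameThreeNeronScalarLawIIIstar`, conjunct 2 (`VeluPairThriceMinimal`; cell bsd-f2-manin, MEMO-an §66; census
8 650 / 8 650 `III* → III` rational `3`-isogenies, all `u = 3`): on a globally minimal `W/ℚ`, TAME at `3` (`9 ∥ N`) with
`ord₃ Δ_min = 9`, `ord₃ j ≥ 0` (pot.-good `III*`), for every rational `3`-line some globally minimal curve `W'/ℚ` carries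
`(3⁻⁴, 3⁻⁶)` times the `u = 1` Vélu pair: `3⁴c₄(W') = 1440q² − 9c₄(W)`, `3⁶c₆(W') = 60480q³ − 756c₄(W)q − 27c₆(W)`** — i.e.
`u(W → W/C) = 3`. [cite: DokchitserDokchitser2015LocalInvariants, Table 1 (l = p, pot.-good)] [cite: SilvermanATAEC1994, IV.9.4 Table 4.1] -/
theorem exists_isGloballyMinimal_three_velu_three_of_IIIstar (W : WeierstrassCurve ℚ) [W.IsElliptic]
    [W.IsGloballyMinimal] (h9 : 3 ^ 2 ∣ W.conductorNorm ℤ) (h27 : ¬ 3 ^ 3 ∣ W.conductorNorm ℤ)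
    (hΔ : padicValInt 3 W.minimalDiscriminantInt = 9) (hj : 0 ≤ padicValRat 3 W.j)
    (q : ℚ) (hq : W.Ψ₃.eval (q - W.b₂ / 12) = 0) :
    ∃ W' : WeierstrassCurve ℚ, W'.IsElliptic ∧ W'.IsGloballyMinimal ∧
      (3 : ℚ) ^ 4 * W'.c₄ = 1440 * q ^ 2 - 9 * W.c₄ ∧
      (3 : ℚ) ^ 6 * W'.c₆ = 60480 * q ^ 3 - 756 * W.c₄ * q - 27 * W.c₆ := by
  -- nonsingularity of the pair from the `III*` computation of p642603: the explicit model `M` has `Δ(M) = 3⁻¹² Δ(pair)`,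
  -- and a singular pair would make every carrier singular; we use the short carrier and `c_relation` of `M`… simpler:
  -- the root relation gives `Ψ₃`-nonsingularity via p3-g6's Bézout certificate `velu_three_discr_ne_zero`.
  have hne : (1440 * q ^ 2 - 9 * W.c₄) ^ 3 ≠ (60480 * q ^ 3 - 756 * W.c₄ * q - 27 * W.c₆) ^ 2 := by
    -- the relation `48q⁴ − 24g₂q² − 48g₃q − g₂² = 0`, `g₂ = c₄/12`, `g₃ = c₆/216`
    have hq' := hq
    rw [Ψ₃_eval_sub_b₂_div_twelve] at hq'
    simp only [WeierstrassCurve.Ψ₃, WeierstrassCurve.b₂, WeierstrassCurve.b₄, WeierstrassCurve.b₆, WeierstrassCurve.b₈,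
      eval_add, eval_mul, eval_pow, eval_C, eval_X, eval_ofNat] at hq'
    have hψ : 48 * q ^ 4 - 24 * (W.c₄ / 12) * q ^ 2 - 48 * (W.c₆ / 216) * q - (W.c₄ / 12) ^ 2 = 0 := by
      linear_combination 16 * hq'
    have hΔ₀ : (W.c₄ / 12) ^ 3 - 27 * (W.c₆ / 216) ^ 2 ≠ 0 := by
      have hΔW : W.Δ ≠ 0 := by rw [← WeierstrassCurve.coe_Δ']; exact W.Δ'.ne_zero
      intro h0; apply hΔW
      linear_combination W.c_relation / 1728 + h0
    have h := velu_three_discr_ne_zero hψ hΔ₀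
    intro heq; apply h
    linear_combination heq / 1728
  obtain ⟨W', k, hW'e, hW'm, hk3, h4, h6⟩ := exists_isGloballyMinimal_dvd_three_velu_three W q hq hne
  rcases int_dvd_three hk3 with rfl | rfl | rfl | rfl
  · exfalso
    exact not_exists_isGloballyMinimal_velu_three_of_IIIstar W h9 h27 hΔ hj q hq
      ⟨W', hW'e, hW'm, by linear_combination h4, by linear_combination h6⟩
  · exfalso
    exact not_exists_isGloballyMinimal_velu_three_of_IIIstar W h9 h27 hΔ hj q hq
      ⟨W', hW'e, hW'm, by linear_combination h4, by linear_combination h6⟩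
  · exact ⟨W', hW'e, hW'm, by exact_mod_cast h4, by exact_mod_cast h6⟩
  · refine ⟨W', hW'e, hW'm, ?_, ?_⟩
    · rw [← h4]; push_cast; ring
    · rw [← h6]; push_cast; ring

end Summit.BirchSwinnertonDyer.BirchSwinnertonDyer.Theorems.ManinLocalTwoThree

end
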